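import Summits.QuantumFields.YangMills.Theses.BalabanUVNodes
import Summits.QuantumFields.YangMills.Theorems.BalabanUVNodesN27AtAllPinsOfRecord13CoPHVCutFSCKingMechanismZ4
import Summits.QuantumFields.YangMills.Theorems.BalabanUVNodesN20OffLiveOneTermReading

/-!
# ★ K3⁷ LEAF: THE ITEM `Theses.BalabanUVNodes.SpineGivenEndpointR13SepCoPH` FROM A STAGE-13 RATE READING CARRYING ALL FOUR PINS OF THE SKELETON OF RECORD (v5 941dddb108cbaacf) WITH THE NODE-U3
# INPUTS `hdec` ((D4)) AND `h18` (N18) PRODUCED BY KING's THREE-FACTOR MECHANISM ON ℤ⁴ LATTICES for the record's LIMITING (1.21) kernels (storey APKZ `…N27AtAllPinsOfRecord13CoPHVCutFSCKingMechanismZ4` §0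
# `kernelRowsOfRecord₁₃_guarded_of_kingMechanismZ4` over dag-n18-w4's FILE 4 §10, p610557 — geometry rows discharged by [B12]'s `K₁`) and the N22 input from dag-n18-w2's finite-volume door
# (`n22At_u3OfRecord₁₃_objectsOfRecord₁₃_of_geometricIncrements_of_windowedNE9`, p606911: `hr hinc h9`) — the `…_of_kingMechanismZ4` edition of leaf APFL `…SepCoPHAllPinsOfRecordVFiniteVolume` (p609783; a
# leaf, NOT imported: its §1∕§2 split is REPLAYED); spine reading PINNED AT LIVE (storey APKZ §2) with the off-live part at a free `cr'` (§1) or at dag-n20-w1's one-term reading (§2)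
# (cell `pub-ymgap`, HUMAN RULING D-0062 Track A, R134 seat `pub-ymgap-dag-n27-c` (N27 B5 composite, s2) gen 14, HOME trigger (t2⁗) — dag-n18-w4 OFFER (A) ∕ FILE 4; `--kind proof --supports
# stmt-QuantumFields-20544 --as helper`; COUNT-NEUTRAL; TWO theorems, 0 `def`, 0 `sorry`; a route-facing leaf, nothing may import it)

WHAT THIS LEAF DISPLAYS (`N = 2`, guard `θ.ZhUnity F 2 ∧ θ.SlotsNondegenerate₁₃ F 2`, `hP := h.toCore`): THE ITEM from — the four reading pins of v5's `GuardedReadingN16` BY NAME∕BODY (`hpin1 :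
Ne1PinnedOfRecord 𝔯`, `hpin2` = the `N15PinnedSized 𝔯` body, `hpinL : N16PinnedLoose 𝔯 ℓ₃ B`, `hpin` = the `U3PinnedKernels 𝔯 ℓ` body); `h16` = ONE sentence `N16HolderAt … β` per guarded family
at the loose-data object; the U3 letter rows `hs hκ hcr hρ`; THREE finite-volume kernel rows `hr : r F θ < 1`, `hinc : GeometricIncrementsOfRecord₁₃ F 2 θ (r F θ)`, `h9 : WindowedNE9OfRecord₁₃ … κ
moduli` (⟹ N22 at every run length, dag-n18-w2); KING's FOURTEEN ℤ⁴ MECHANISM ROWS keyed on the guard — signs `hks` (`κK > 0`) · injective ℤ⁴ reading `hq` of a level-indexed lattice `βK F θ k` · end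
positions at separation `≥ |z|₁` (`hd`) · three-factor factorisations `hEA hEB` of the record's limiting kernel functionals `(objectsOfRecord₁₃ F 2 θ' ℓ).EA k g () (pt k μ ν z) = u_A ⬝ (E_A v_A)`,
`.EB k b g (bg …) (pt …) = u_B ⬝ (E_B v_B)` · k-UNIFORM sizes `hu hCA hvA hCB hvB` · ONE-LINE RATES `hdu hdC hdv ≤ c·θK^{k+1}` · domination `hdom` against the block `ℓ F θ` with [B12]'s `K₁(4, κK∕2)²`
(⟹ (D4)'s `KernelDecayOfRecord₁₃ … 0 1 κ` and N18 at every run length, storey APKZ §0); and then per theorem — §1: live `hζm h20 h21 h19` (keyed witnesses, N27x = UC §0's theorem) + off-live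
`h20' h21' hx' h19'` at a free `cr'`; §2: off-live ONE Target row `htarget` at `crOneTerm₁₃ K₀`.  Every `h19`-type face is FSC-keyed at v5's `PHolderD4 β` SPELLED.  NO pseudo-distance ∕ lattice-sum
rows, NO windowed step-rate ∕ windowed (5.10) letter, NO (1.21)-existence letter.

HONEST FRAMING.  COMPOSITE-node bookkeeping BY NAME; NOT a discharge: two terms of the item's type under displayed hypotheses (audit `proof.conditional`), every one a HYPOTHESIS inhabited
for no family today (K0⁷ `Record13SepCoPHInhabited` OPEN) or a decided MODEL behind a pin (n14-w1's «budget only» tower reading the datum's scheme; dag-n15-a's sized genuine objects, MODEL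
LEVEL); pins are hypotheses on a FREE reading `𝔯` (no reading minted); N16 at the loose-data object = THE END's content as a hypothesis (`B` a free letter); KING's ROWS ARE HYPOTHESES — the
three-factor structure ∕ k-uniform sizes ∕ one-line rates of Bałaban's limiting (1.21) kernel functionals over ℤ⁴-read lattices ARE the N18 ∕ (D4) estimate ([King1986] Prop. 3.9 (3.73) p. 665,
(4.42)–(4.43) p. 675 typed by dag-n18-w4; NOT PRINTED for d = 4 Yang–Mills — [Balaban1987RG1] Thm 1 p. 259 prints uniformity only — and proved nowhere in the tree; only the geometry is
discharged); the remaining finite-volume letters (geometric increments at rate `r < 1`, windowed history-NE9) are Bałaban-type SHAPES NOT PRINTED as such; NE7-cluster ∕ K5 ∕ the N19′ edge ∕ node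
U5's Target 0∕1 today; `β`, `ℓ.ρ`, `r`, ALL King data and letters FREE; nothing of Bałaban's or King's asserted or instantiated; NOT `stub_rates13H` ∕ `stub_expansion13H` (per-reading reductions at
the pins); N14–N22 ∕ N27 NOT discharged; K3⁷ OPEN, NOT claimed; skeleton v5 and every landed decl UNTOUCHED; counts UNMOVED (typed 28∕28 · discharged 5∕27, A 5∕28); one finite four-torus
programme at fixed `ε` — R4 closes the conditional rung `BalabanLadder.UV` only: NOT ℝ⁴, NOT infinite volume, NOT OS, NOT a mass gap, NOT Clay.  No decl below carries a cite tag.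
-/

set_option autoImplicit false

namespace Summit.QuantumFields.YangMills.Theorems.BalabanUVNodesN27SpineRecord

open scoped BigOperators Matrix.Norms.L2Operator
open Literature.MathematicalPhysics.QuantumFieldTheory.Balaban1983to89
open Literature.MathematicalPhysics.QuantumFieldTheory.Balaban1983to89.T4Continuum
open Literature.MathematicalPhysics.QuantumFieldTheory.Balaban1983to89.Node00
open Literature.MathematicalPhysics.QuantumFieldTheory.Balaban1983to89.B12Sec2to5 (betaPrime510 l1)
open Literature.MathematicalPhysics.QuantumFieldTheory.Balaban1983to89.B12Decay510Window (K₁)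
open Literature.MathematicalPhysics.QuantumFieldTheory.Balaban1983to89.T4OutputRate (Window)
open Literature.MathematicalPhysics.QuantumFieldTheory.Balaban1983to89.Node00.U3OfKernels (objectsOfRecord₁₃ KernelDecayOfRecord₁₃ pt bg)
open Literature.MathematicalPhysics.QuantumFieldTheory.Balaban1983to89.Node00.U3KernelLetters (GeometricIncrementsOfRecord₁₃ WindowedNE9OfRecord₁₃ WindowedDecayOfRecord₁₃
  WindowedStepRateOfRecord₁₃)
open T4WeightBudget (RelWeightBound)
open T4IndicatorShell (ShellWeightBound)
open T4ContinuumYM4Torus (ForSmallCouplings)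
open Summit.QuantumFields.BalabanUV.T4Continuum.Spine
open Summit.QuantumFields.BalabanUV.T4Continuum.MinimalActionRate (sfClass)
open Summit.QuantumFields.YangMills.Theses.BalabanUVNodes (SpineGivenEndpointR13SepCoPH)
open YMDAG.UVSplit
open Summit.QuantumFields.YangMills.BalabanUVNodes.N19TargetClassWeightsE1Keyed
open Summit.QuantumFields.YangMills.BalabanUVNodes.N16HolderDefs (N16HolderAt)
open Summit.QuantumFields.YangMills.BalabanUVNodes.SpineRatesHolder (RatesHolderAt)
open YMDAG.N14.TopBorn (Ne1PinnedOfRecord n14At_rateCarriersOfRecord₁₃CoPH_of_pinned)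
open Summit.QuantumFields.YangMills.BalabanUVNodes.N15.GenuineRecord (fullGSizedObjects n15At_fullGSizedObjects_family)
open Summit.QuantumFields.YangMills.BalabanUVNodes.N15.AtKeyedHome (neZero_blockFactor)
open Summit.QuantumFields.YangMills.BalabanUVNodes.N16PinnedLayer13CoPH (N16PinnedLoose rateCarriers_ne3_of_pinnedLoose)
open YMDAG.N18.PolLimitRate (n22At_u3OfRecord₁₃_objectsOfRecord₁₃_of_geometricIncrements_of_windowedNE9)
open NE7 (Target)
open Matrix
open Summit.QuantumFields.YangMills.BalabanUVNodes.N20OffLiveOneTermReading (crOneTerm₁₃ h20_shape_crOneTerm₁₃ h21_shape_crOneTerm₁₃ hx_shape_crOneTerm₁₃ core_crOneTerm₁₃_iff_target)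

variable (K₀ : ℕ) (jc : (F : T4Family) → (θ : Stage13HParams F 2) → θ.Provisos₁₃CoPH F 2 → (ℕ → ℝ) → List (ULoop F) → ℕ → ℕ)
  (sh : ShellSplit₁₃CoPH 2 K₀)
  (cr cr' : (F : T4Family) → (θ : Stage13HParams F 2) → θ.Provisos₁₃CoPH F 2 → (ℕ → ℝ) → List (ULoop F) → SpineCarriers)
  (β : ℝ) (𝔯 : RateReading₁₃CoPH 2)
  (ksel : (F : T4Family) → (θ : Stage13HParams F 2) → θ.Provisos₁₃CoPH F 2 → (ℕ → ℝ) → List (ULoop F) → ℕ)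
  (ℓ : (F : T4Family) → Stage13HParams F 2 → U3Letters₁₁) (s : (F : T4Family) → Stage13HParams F 2 → ℕ) (r : (F : T4Family) → Stage13HParams F 2 → ℝ)
  (ℓ₃ : T4Family → NE3Letters₁₁) (B : T4Family → ℝ)

-- KING's three-factor data for the record's LIMITING kernels on ℤ⁴ lattices (storey APKZ ∕ dag-n18-w4 FILE 4 §10), `(F, θ)`-dependent; `k` = level, `g` = window history, `b` = run B's first coupling
variable {βK : (F : T4Family) → Stage13HParams F 2 → ℕ → Type*} [∀ F θ k, Fintype (βK F θ k)]
  (q : (F : T4Family) → (θ : Stage13HParams F 2) → (k : ℕ) → βK F θ k → (Fin 4 → ℤ))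
  (p₁ p₂ : (F : T4Family) → (θ : Stage13HParams F 2) → (k : ℕ) → Fin 4 → Fin 4 → (Fin 4 → ℤ) → (Fin 4 → ℤ))
  (uA vA : (F : T4Family) → (θ : Stage13HParams F 2) → (ℕ → ℝ) → (k : ℕ) → Fin 4 → Fin 4 → (Fin 4 → ℤ) → βK F θ k → ℝ)
  (CA : (F : T4Family) → (θ : Stage13HParams F 2) → (ℕ → ℝ) → (k : ℕ) → Fin 4 → Fin 4 → (Fin 4 → ℤ) → Matrix (βK F θ k) (βK F θ k) ℝ)
  (uB vB : (F : T4Family) → (θ : Stage13HParams F 2) → ℝ → (ℕ → ℝ) → (k : ℕ) → Fin 4 → Fin 4 → (Fin 4 → ℤ) → βK F θ k → ℝ)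
  (CB : (F : T4Family) → (θ : Stage13HParams F 2) → ℝ → (ℕ → ℝ) → (k : ℕ) → Fin 4 → Fin 4 → (Fin 4 → ℤ) → Matrix (βK F θ k) (βK F θ k) ℝ)
  (κK θK sA sC sB cA cC cB : (F : T4Family) → Stage13HParams F 2 → ℝ)

/-! ## §1 THE ITEM: all four reading pins everywhere, the spine reading PINNED AT LIVE (storey APKZ §2) and free off the live line ((Kꜰ) at `cr'`, rows discharged the same way, u3 inputs from APKZ §0 + dag-n18-w2) -/

/-- ★★★ **THE ITEM IN THE SHAPE OF K3⁷ v5's TWO STUBS AT ALL THEIR PINS, N18 ∕ (D4) INPUTS FROM KING's MECHANISM ON ℤ⁴ LATTICES (LIMITING KERNELS), N22 FROM FINITE-VOLUME LETTERS** — APFL §1's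
split REPLAYED: live = APKZ §2 `spine_rec13CCoPHOn_live_of_v5pins_fsc_at_crOfRecord₁₃VAt_cut_of_kingMechanismZ4` (spine reading `crOfRecord₁₃VAt K₀ (jc …) sh`, keyed N20 ∕ N21 witnesses `h20 h21`,
law `hζm`, FSC `h19` to a summable `NE7.Core 1 (F.side ^ 4)` witness; N27x a theorem); off-live = (Kꜰ) `hybridNE7Under_of_kernels_pin_fsc` at a free `cr'` (`h20' h21' hx' h19'`), rows discharged
behind the pins, `hdec h18 := kernelRowsOfRecord₁₃_guarded_of_kingMechanismZ4 …` (APKZ §0 at the guard), `h22 :=` dag-n18-w2's door; U `spine_rec13CCoPHOn_of_split`; `hP := h.toCore`.  THE ITEM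
then costs, binder by binder: the four pins · `h16` · `hs hκ hcr hρ` · `hr hinc h9` · the FOURTEEN ℤ⁴ King rows · live `hζm h20 h21 h19` · off-live `h20' h21' hx' h19'`.  NOT a discharge: every row
a HYPOTHESIS or a decided MODEL (K0⁷ OPEN); King's rows NOT PRINTED for d = 4; NOT `stub_rates13H` ∕ `stub_expansion13H`; no node discharged. [bookkeeping] -/
theorem spineGivenEndpointR13SepCoPH_of_liveV5PinsAtCrOfRecord₁₃VAt_cut_offLive_v5pins_fsc_of_kingMechanismZ4
    (hpin1 : Ne1PinnedOfRecord 𝔯)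
    (hpin2 : ∃ (b aS : ℝ) (ν μ α β' : Fin 4) (c35 p : ℝ), 0 < b ∧ 0 < aS ∧
      ∀ (F : T4Family) (θ : Stage13HParams F 2) (hP : θ.Provisos₁₃CoPH F 2) (g₀ : ℕ → ℝ) (os : List (ULoop F)) (k : ℕ),
        (𝔯.lit F θ hP g₀ os).ne2 k = haveI := neZero_blockFactor F; fullGSizedObjects 3 F.hL b aS ν μ α β' c35 p)
    (hpinL : N16PinnedLoose 𝔯 ℓ₃ B)
    (hpin : ∀ (F : T4Family) (θ : Stage13HParams F 2) (hP : θ.Provisos₁₃CoPH F 2) (g₀ : ℕ → ℝ) (os : List (ULoop F)),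
      (𝔯.lit F θ hP g₀ os).u3 = objectsOfRecord₁₃ F 2 θ.toStage13Params (ℓ F θ))
    (h16 : ∀ (F : T4Family), (∃ θ : Stage13HParams F 2, θ.Provisos₁₃CoPH F 2 ∧ (θ.ZhUnity F 2 ∧ θ.SlotsNondegenerate₁₃ F 2) ∧ θ.Admissible F 2) →
      N16HolderAt (ne3OfRecord₁₁ F { ne3ConstLayerOfRecord₁₁ F 2 (ℓ₃ F) with
        dom := {V | V ∈ ne3DomOfRecord₁₁ F 2 0 0 ∧ V ∈ sfClass 4 F.L (ne3NperOfRecord₁₁ F 0 0) ((ℓ₃ F).ε / B F) 0} }) β)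
    (hs : ∀ (F : T4Family) (θ : Stage13HParams F 2), θ.Provisos₁₃CoPH F 2 → (θ.ZhUnity F 2 ∧ θ.SlotsNondegenerate₁₃ F 2) → θ.Admissible F 2 → (ℓ F θ).Signs)
    (hκ : ∀ (F : T4Family) (θ : Stage13HParams F 2), θ.Provisos₁₃CoPH F 2 → (θ.ZhUnity F 2 ∧ θ.SlotsNondegenerate₁₃ F 2) → θ.Admissible F 2 → 0 < (ℓ F θ).κ)
    (hcr : ∀ (F : T4Family) (θ : Stage13HParams F 2), θ.Provisos₁₃CoPH F 2 → (θ.ZhUnity F 2 ∧ θ.SlotsNondegenerate₁₃ F 2) → θ.Admissible F 2 →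
      betaPrime510 4 1 (ℓ F θ).κ ≤ (ℓ F θ).cr)
    (hρ : ∀ (F : T4Family) (θ : Stage13HParams F 2), θ.Provisos₁₃CoPH F 2 → (θ.ZhUnity F 2 ∧ θ.SlotsNondegenerate₁₃ F 2) → θ.Admissible F 2 →
      0 ≤ (ℓ F θ).ρ ∧ (ℓ F θ).ρ < 1)
    (hr : ∀ (F : T4Family) (θ : Stage13HParams F 2), θ.Provisos₁₃CoPH F 2 → (θ.ZhUnity F 2 ∧ θ.SlotsNondegenerate₁₃ F 2) → θ.Admissible F 2 → r F θ < 1)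
    (hinc : ∀ (F : T4Family) (θ : Stage13HParams F 2), θ.Provisos₁₃CoPH F 2 → (θ.ZhUnity F 2 ∧ θ.SlotsNondegenerate₁₃ F 2) → θ.Admissible F 2 →
      GeometricIncrementsOfRecord₁₃ F 2 θ.toStage13Params (r F θ))
    (h9 : ∀ (F : T4Family) (θ : Stage13HParams F 2), θ.Provisos₁₃CoPH F 2 → (θ.ZhUnity F 2 ∧ θ.SlotsNondegenerate₁₃ F 2) → θ.Admissible F 2 →
      WindowedNE9OfRecord₁₃ F 2 θ.toStage13Params (ℓ F θ).κ (ℓ F θ).moduli)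
    (hks : ∀ (F : T4Family) (θ : Stage13HParams F 2), θ.Provisos₁₃CoPH F 2 → (θ.ZhUnity F 2 ∧ θ.SlotsNondegenerate₁₃ F 2) → θ.Admissible F 2 →
      0 < κK F θ ∧ 0 ≤ θK F θ ∧ 0 ≤ sA F θ ∧ 0 ≤ sC F θ ∧ 0 ≤ sB F θ ∧ 0 ≤ cA F θ ∧ 0 ≤ cC F θ ∧ 0 ≤ cB F θ)
    (hq : ∀ (F : T4Family) (θ : Stage13HParams F 2) (k : ℕ), Function.Injective (q F θ k))
    (hd : ∀ (F : T4Family) (θ : Stage13HParams F 2) (k : ℕ) (μ ν : Fin 4) (z : Fin 4 → ℤ), l1 z ≤ l1 (p₁ F θ k μ ν z - p₂ F θ k μ ν z))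
    (hEA : ∀ (F : T4Family) (θ : Stage13HParams F 2), θ.Provisos₁₃CoPH F 2 → (θ.ZhUnity F 2 ∧ θ.SlotsNondegenerate₁₃ F 2) → θ.Admissible F 2 →
      ∀ g ∈ Window θ.γ, ∀ (k : ℕ) (μ ν : Fin 4) (z : Fin 4 → ℤ),
        (objectsOfRecord₁₃ F 2 θ.toStage13Params (ℓ F θ)).EA k g PUnit.unit (pt k μ ν z) = uA F θ g k μ ν z ⬝ᵥ (CA F θ g k μ ν z *ᵥ vA F θ g k μ ν z))
    (hEB : ∀ (F : T4Family) (θ : Stage13HParams F 2), θ.Provisos₁₃CoPH F 2 → (θ.ZhUnity F 2 ∧ θ.SlotsNondegenerate₁₃ F 2) → θ.Admissible F 2 →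
      ∀ b : ℝ, 0 < b → b ≤ θ.γ → ∀ g ∈ Window θ.γ, ∀ (k : ℕ) (μ ν : Fin 4) (z : Fin 4 → ℤ),
        (objectsOfRecord₁₃ F 2 θ.toStage13Params (ℓ F θ)).EB k b g (bg k μ ν z) (pt k μ ν z) = uB F θ b g k μ ν z ⬝ᵥ (CB F θ b g k μ ν z *ᵥ vB F θ b g k μ ν z))
    (hu : ∀ (F : T4Family) (θ : Stage13HParams F 2), θ.Provisos₁₃CoPH F 2 → (θ.ZhUnity F 2 ∧ θ.SlotsNondegenerate₁₃ F 2) → θ.Admissible F 2 →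
      ∀ g ∈ Window θ.γ, ∀ (k : ℕ) (μ ν : Fin 4) (z : Fin 4 → ℤ) (i : βK F θ k),
        |uA F θ g k μ ν z i| ≤ sA F θ * Real.exp (-(κK F θ * l1 (p₁ F θ k μ ν z - q F θ k i))))
    (hCA : ∀ (F : T4Family) (θ : Stage13HParams F 2), θ.Provisos₁₃CoPH F 2 → (θ.ZhUnity F 2 ∧ θ.SlotsNondegenerate₁₃ F 2) → θ.Admissible F 2 →
      ∀ g ∈ Window θ.γ, ∀ (k : ℕ) (μ ν : Fin 4) (z : Fin 4 → ℤ) (i i' : βK F θ k),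
        |CA F θ g k μ ν z i i'| ≤ sC F θ * Real.exp (-(κK F θ * l1 (q F θ k i - q F θ k i'))))
    (hvA : ∀ (F : T4Family) (θ : Stage13HParams F 2), θ.Provisos₁₃CoPH F 2 → (θ.ZhUnity F 2 ∧ θ.SlotsNondegenerate₁₃ F 2) → θ.Admissible F 2 →
      ∀ g ∈ Window θ.γ, ∀ (k : ℕ) (μ ν : Fin 4) (z : Fin 4 → ℤ) (i' : βK F θ k),
        |vA F θ g k μ ν z i'| ≤ sB F θ * Real.exp (-(κK F θ * l1 (q F θ k i' - p₂ F θ k μ ν z))))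
    (hCB : ∀ (F : T4Family) (θ : Stage13HParams F 2), θ.Provisos₁₃CoPH F 2 → (θ.ZhUnity F 2 ∧ θ.SlotsNondegenerate₁₃ F 2) → θ.Admissible F 2 →
      ∀ b : ℝ, 0 < b → b ≤ θ.γ → ∀ g ∈ Window θ.γ, ∀ (k : ℕ) (μ ν : Fin 4) (z : Fin 4 → ℤ) (i i' : βK F θ k),
        |CB F θ b g k μ ν z i i'| ≤ sC F θ * Real.exp (-(κK F θ * l1 (q F θ k i - q F θ k i'))))
    (hvB : ∀ (F : T4Family) (θ : Stage13HParams F 2), θ.Provisos₁₃CoPH F 2 → (θ.ZhUnity F 2 ∧ θ.SlotsNondegenerate₁₃ F 2) → θ.Admissible F 2 →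
      ∀ b : ℝ, 0 < b → b ≤ θ.γ → ∀ g ∈ Window θ.γ, ∀ (k : ℕ) (μ ν : Fin 4) (z : Fin 4 → ℤ) (i' : βK F θ k),
        |vB F θ b g k μ ν z i'| ≤ sB F θ * Real.exp (-(κK F θ * l1 (q F θ k i' - p₂ F θ k μ ν z))))
    (hdu : ∀ (F : T4Family) (θ : Stage13HParams F 2), θ.Provisos₁₃CoPH F 2 → (θ.ZhUnity F 2 ∧ θ.SlotsNondegenerate₁₃ F 2) → θ.Admissible F 2 →
      ∀ b : ℝ, 0 < b → b ≤ θ.γ → ∀ g ∈ Window θ.γ, ∀ (k : ℕ) (μ ν : Fin 4) (z : Fin 4 → ℤ) (i : βK F θ k),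
        |uB F θ b g k μ ν z i - uA F θ g k μ ν z i| ≤ cA F θ * θK F θ ^ (k + 1) * Real.exp (-(κK F θ * l1 (p₁ F θ k μ ν z - q F θ k i))))
    (hdC : ∀ (F : T4Family) (θ : Stage13HParams F 2), θ.Provisos₁₃CoPH F 2 → (θ.ZhUnity F 2 ∧ θ.SlotsNondegenerate₁₃ F 2) → θ.Admissible F 2 →
      ∀ b : ℝ, 0 < b → b ≤ θ.γ → ∀ g ∈ Window θ.γ, ∀ (k : ℕ) (μ ν : Fin 4) (z : Fin 4 → ℤ) (i i' : βK F θ k),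
        |CB F θ b g k μ ν z i i' - CA F θ g k μ ν z i i'| ≤ cC F θ * θK F θ ^ (k + 1) * Real.exp (-(κK F θ * l1 (q F θ k i - q F θ k i'))))
    (hdv : ∀ (F : T4Family) (θ : Stage13HParams F 2), θ.Provisos₁₃CoPH F 2 → (θ.ZhUnity F 2 ∧ θ.SlotsNondegenerate₁₃ F 2) → θ.Admissible F 2 →
      ∀ b : ℝ, 0 < b → b ≤ θ.γ → ∀ g ∈ Window θ.γ, ∀ (k : ℕ) (μ ν : Fin 4) (z : Fin 4 → ℤ) (i' : βK F θ k),
        |vB F θ b g k μ ν z i' - vA F θ g k μ ν z i'| ≤ cB F θ * θK F θ ^ (k + 1) * Real.exp (-(κK F θ * l1 (q F θ k i' - p₂ F θ k μ ν z))))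
    (hdom : ∀ (F : T4Family) (θ : Stage13HParams F 2), θ.Provisos₁₃CoPH F 2 → (θ.ZhUnity F 2 ∧ θ.SlotsNondegenerate₁₃ F 2) → θ.Admissible F 2 →
      (ℓ F θ).κ ≤ κK F θ / 2 ∧ θK F θ ≤ (ℓ F θ).θ₅ ∧
        (cA F θ * sC F θ * sB F θ + sA F θ * cC F θ * sB F θ + sA F θ * sC F θ * cB F θ) * K₁ 4 (κK F θ / 2) ^ 2 ≤ (ℓ F θ).C₅)
    (hζm : ∀ (F : T4Family) (θ : Stage13HParams F 2), θ.Provisos₁₃CoPH F 2 → ((θ.ZhUnity F 2 ∧ θ.SlotsNondegenerate₁₃ F 2) ∧ θ.ppSel = ppSelLiveOfRecord F 2 θ.ν θ.τ9 (EOfRecord₁₃ F 2 θ.toStage13Params) (wOfRecord₉ F 2 θ.toStage9Params)) → θ.Admissible F 2 →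
      ZetaMeasurable F 2 θ.ζ)
    (h20 : ∀ (F : T4Family) (θ : Stage13HParams F 2) (hP : θ.Provisos₁₃CoPH F 2), ((θ.ZhUnity F 2 ∧ θ.SlotsNondegenerate₁₃ F 2) ∧ θ.ppSel = ppSelLiveOfRecord F 2 θ.ν θ.τ9 (EOfRecord₁₃ F 2 θ.toStage13Params) (wOfRecord₉ F 2 θ.toStage9Params)) → θ.Admissible F 2 →
      ∀ (g₀ : ℕ → ℝ) (os : List (ULoop F)),
        ∃ W : ℕ → ℝ, RelWeightBound 1 (classSet₁₃ θ K₀ g₀) (weightA₁₃ θ hP K₀ g₀ os) (weightB₁₃ θ hP K₀ g₀ os) (badClass₁₃ θ K₀ g₀ (jc F θ hP g₀ os)) W)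
    (h21 : ∀ (F : T4Family) (θ : Stage13HParams F 2) (hP : θ.Provisos₁₃CoPH F 2), ((θ.ZhUnity F 2 ∧ θ.SlotsNondegenerate₁₃ F 2) ∧ θ.ppSel = ppSelLiveOfRecord F 2 θ.ν θ.τ9 (EOfRecord₁₃ F 2 θ.toStage13Params) (wOfRecord₉ F 2 θ.toStage9Params)) → θ.Admissible F 2 →
      ∀ (g₀ : ℕ → ℝ) (os : List (ULoop F)),
        ∃ Wsh : ℕ → ℝ, ShellWeightBound 1 (classSet₁₃ θ K₀ g₀) (weightA₁₃ θ hP K₀ g₀ os) (weightB₁₃ θ hP K₀ g₀ os) (sh F θ hP g₀ os).1 (sh F θ hP g₀ os).2 Wsh)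
    (h19 : ∀ (F : T4Family) (θ : Stage13HParams F 2) (hP : θ.Provisos₁₃CoPH F 2), ((θ.ZhUnity F 2 ∧ θ.SlotsNondegenerate₁₃ F 2) ∧ θ.ppSel = ppSelLiveOfRecord F 2 θ.ν θ.τ9 (EOfRecord₁₃ F 2 θ.toStage13Params) (wOfRecord₉ F 2 θ.toStage9Params)) → θ.Admissible F 2 →
      B16.EndStatementBPrinted (datumOfRecord₁₃CoPH F 2 θ hP).C → DagBinding.EndpointExistence (datumOfRecord₁₃CoPH F 2 θ hP).C.toB12 →
        ForSmallCouplings (datumOfRecord₁₃CoPH F 2 θ hP) fun g₀ => ∀ os : List (ULoop F),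
          (RatesHolderAt (datumOfRecord₁₃CoPH F 2 θ hP) (rateCarriersOfRecord₁₃CoPH 𝔯 F θ hP g₀ os (ksel F θ hP g₀ os)) β ∧
              ReadOutAt (datumOfRecord₁₃CoPH F 2 θ hP) (rateCarriersOfRecord₁₃CoPH 𝔯 F θ hP g₀ os (ksel F θ hP g₀ os)).u3 ∧
              (0 ≤ (rateCarriersOfRecord₁₃CoPH 𝔯 F θ hP g₀ os (ksel F θ hP g₀ os)).u3.ρ ∧
                (rateCarriersOfRecord₁₃CoPH 𝔯 F θ hP g₀ os (ksel F θ hP g₀ os)).u3.ρ < 1)) →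
            letI : DecidableEq (Σ K, SiteSeqKey F (K₀ + K)) := Classical.decEq _
            ∃ δ : ℕ → ℝ, NE7.Core 1 (F.side ^ 4) (classSet₁₃ θ K₀ g₀) (badClass₁₃ θ K₀ g₀ (jc F θ hP g₀ os))
              (fun K t x => weightA₁₃ θ hP K₀ g₀ os K t x - (sh F θ hP g₀ os).1 K t x)
              (fun K t x => weightB₁₃ θ hP K₀ g₀ os K t x - (sh F θ hP g₀ os).2 K t x) δ ∧ Summable δ)
    (h20' : ∀ (F : T4Family) (θ : Stage13HParams F 2) (hP : θ.Provisos₁₃CoPH F 2), ((θ.ZhUnity F 2 ∧ θ.SlotsNondegenerate₁₃ F 2) ∧ ¬ θ.ppSel = ppSelLiveOfRecord F 2 θ.ν θ.τ9 (EOfRecord₁₃ F 2 θ.toStage13Params) (wOfRecord₉ F 2 θ.toStage9Params)) → θ.Admissible F 2 →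
      ∀ (g₀ : ℕ → ℝ) (os : List (ULoop F)),
        RelWeightBound (cr' F θ hP g₀ os).l₀ (cr' F θ hP g₀ os).T (cr' F θ hP g₀ os).A (cr' F θ hP g₀ os).B (cr' F θ hP g₀ os).Bad (cr' F θ hP g₀ os).W)
    (h21' : ∀ (F : T4Family) (θ : Stage13HParams F 2) (hP : θ.Provisos₁₃CoPH F 2), ((θ.ZhUnity F 2 ∧ θ.SlotsNondegenerate₁₃ F 2) ∧ ¬ θ.ppSel = ppSelLiveOfRecord F 2 θ.ν θ.τ9 (EOfRecord₁₃ F 2 θ.toStage13Params) (wOfRecord₉ F 2 θ.toStage9Params)) → θ.Admissible F 2 →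
      ∀ (g₀ : ℕ → ℝ) (os : List (ULoop F)),
        ShellWeightBound (cr' F θ hP g₀ os).l₀ (cr' F θ hP g₀ os).T (cr' F θ hP g₀ os).A (cr' F θ hP g₀ os).B (cr' F θ hP g₀ os).shA (cr' F θ hP g₀ os).shB
          (cr' F θ hP g₀ os).Wsh)
    (hx' : ∀ (F : T4Family) (θ : Stage13HParams F 2) (hP : θ.Provisos₁₃CoPH F 2), ((θ.ZhUnity F 2 ∧ θ.SlotsNondegenerate₁₃ F 2) ∧ ¬ θ.ppSel = ppSelLiveOfRecord F 2 θ.ν θ.τ9 (EOfRecord₁₃ F 2 θ.toStage13Params) (wOfRecord₉ F 2 θ.toStage9Params)) → θ.Admissible F 2 →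
      B16.EndStatementBPrinted (datumOfRecord₁₃CoPH F 2 θ hP).C → DagBinding.EndpointExistence (datumOfRecord₁₃CoPH F 2 θ hP).C.toB12 →
        ForSmallCouplings (datumOfRecord₁₃CoPH F 2 θ hP) fun g₀ => ∀ os : List (ULoop F),
          0 < (cr' F θ hP g₀ os).l₀ ∧ 0 < (cr' F θ hP g₀ os).vol ∧
          (∀ (K : ℕ) (t : ℝ), |t| ≤ (cr' F θ hP g₀ os).l₀ →
            T4GenFunBounds.schemeZ ((datumOfRecord₁₃CoPH F 2 θ hP).scheme g₀) os ((cr' F θ hP g₀ os).K₀ + K) t =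
              ∑ τ ∈ (cr' F θ hP g₀ os).T K, (cr' F θ hP g₀ os).A K t τ) ∧
          (∀ (K : ℕ) (t : ℝ), |t| ≤ (cr' F θ hP g₀ os).l₀ →
            T4GenFunBounds.schemeZ ((datumOfRecord₁₃CoPH F 2 θ hP).scheme g₀) os ((cr' F θ hP g₀ os).K₀ + K + 1) t =
              ∑ τ ∈ (cr' F θ hP g₀ os).T K, (cr' F θ hP g₀ os).B K t τ))
    (h19' : ∀ (F : T4Family) (θ : Stage13HParams F 2) (hP : θ.Provisos₁₃CoPH F 2), ((θ.ZhUnity F 2 ∧ θ.SlotsNondegenerate₁₃ F 2) ∧ ¬ θ.ppSel = ppSelLiveOfRecord F 2 θ.ν θ.τ9 (EOfRecord₁₃ F 2 θ.toStage13Params) (wOfRecord₉ F 2 θ.toStage9Params)) → θ.Admissible F 2 →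
      B16.EndStatementBPrinted (datumOfRecord₁₃CoPH F 2 θ hP).C → DagBinding.EndpointExistence (datumOfRecord₁₃CoPH F 2 θ hP).C.toB12 →
        ForSmallCouplings (datumOfRecord₁₃CoPH F 2 θ hP) fun g₀ => ∀ os : List (ULoop F),
          (RatesHolderAt (datumOfRecord₁₃CoPH F 2 θ hP) (rateCarriersOfRecord₁₃CoPH 𝔯 F θ hP g₀ os (ksel F θ hP g₀ os)) β ∧
              ReadOutAt (datumOfRecord₁₃CoPH F 2 θ hP) (rateCarriersOfRecord₁₃CoPH 𝔯 F θ hP g₀ os (ksel F θ hP g₀ os)).u3 ∧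
              (0 ≤ (rateCarriersOfRecord₁₃CoPH 𝔯 F θ hP g₀ os (ksel F θ hP g₀ os)).u3.ρ ∧
                (rateCarriersOfRecord₁₃CoPH 𝔯 F θ hP g₀ os (ksel F θ hP g₀ os)).u3.ρ < 1)) →
            letI := (cr' F θ hP g₀ os).dec
            ∃ δ : ℕ → ℝ, NE7.Core (cr' F θ hP g₀ os).l₀ (cr' F θ hP g₀ os).vol (cr' F θ hP g₀ os).T (cr' F θ hP g₀ os).Bad
              (fun K t τ => (cr' F θ hP g₀ os).A K t τ - (cr' F θ hP g₀ os).shA K t τ) (fun K t τ => (cr' F θ hP g₀ os).B K t τ - (cr' F θ hP g₀ os).shB K t τ) δ ∧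
              Summable δ) :
    SpineGivenEndpointR13SepCoPH := by
  obtain ⟨hdec, h18⟩ := kernelRowsOfRecord₁₃_guarded_of_kingMechanismZ4 ℓ q p₁ p₂ uA vA CA uB vB CB κK θK sA sC sB cA cC cB
    (fun F (θ : Stage13HParams F 2) => (θ.ZhUnity F 2 ∧ θ.SlotsNondegenerate₁₃ F 2)) hs hks hq hd hEA hEB hu hCA hvA hCB hvB hdu hdC hdv hdom
  have h22 := fun (F : T4Family) (θ : Stage13HParams F 2) (hP : θ.Provisos₁₃CoPH F 2) (hG : (θ.ZhUnity F 2 ∧ θ.SlotsNondegenerate₁₃ F 2)) (hθ : θ.Admissible F 2) (k : ℕ) =>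
    n22At_u3OfRecord₁₃_objectsOfRecord₁₃_of_geometricIncrements_of_windowedNE9 F 2 θ.toStage13Params (ℓ F θ) (hs F θ hP hG hθ) k (hr F θ hP hG hθ) (hinc F θ hP hG hθ) (h9 F θ hP hG hθ)
  exact fun F θ hP hG hθ _ _ =>
    (spine_rec13CCoPHOn_iff_forall_guarded (fun F (θ : Stage13HParams F 2) => (θ.ZhUnity F 2 ∧ θ.SlotsNondegenerate₁₃ F 2))).mp
      (spine_rec13CCoPHOn_of_split (fun F (θ : Stage13HParams F 2) => (θ.ZhUnity F 2 ∧ θ.SlotsNondegenerate₁₃ F 2)) (fun F (θ : Stage13HParams F 2) => θ.ppSel = ppSelLiveOfRecord F 2 θ.ν θ.τ9 (EOfRecord₁₃ F 2 θ.toStage13Params) (wOfRecord₉ F 2 θ.toStage9Params))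
        (spine_rec13CCoPHOn_live_of_v5pins_fsc_at_crOfRecord₁₃VAt_cut_of_kingMechanismZ4 K₀ jc sh β 𝔯 ksel ℓ r ℓ₃ B q p₁ p₂ uA vA CA uB vB CB κK θK sA sC sB cA cC cB
          (fun F (θ : Stage13HParams F 2) => (θ.ZhUnity F 2 ∧ θ.SlotsNondegenerate₁₃ F 2)) hpin1 hpin2 hpinL hpin
          (fun F hF => h16 F (hF.elim fun θ h => ⟨θ, h.1, h.2.1.1, h.2.2⟩))
          (fun F θ hP hRg hθ => hs F θ hP hRg.1 hθ) (fun F θ hP hRg hθ => hκ F θ hP hRg.1 hθ) (fun F θ hP hRg hθ => hcr F θ hP hRg.1 hθ)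
          (fun F θ hP hRg hθ => hρ F θ hP hRg.1 hθ) (fun F θ hP hRg hθ => hr F θ hP hRg.1 hθ) (fun F θ hP hRg hθ => hinc F θ hP hRg.1 hθ)
          (fun F θ hP hRg hθ => h9 F θ hP hRg.1 hθ) (fun F θ hP hRg hθ => hks F θ hP hRg.1 hθ) hq hd (fun F θ hP hRg hθ => hEA F θ hP hRg.1 hθ)
          (fun F θ hP hRg hθ => hEB F θ hP hRg.1 hθ) (fun F θ hP hRg hθ => hu F θ hP hRg.1 hθ) (fun F θ hP hRg hθ => hCA F θ hP hRg.1 hθ)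
          (fun F θ hP hRg hθ => hvA F θ hP hRg.1 hθ) (fun F θ hP hRg hθ => hCB F θ hP hRg.1 hθ) (fun F θ hP hRg hθ => hvB F θ hP hRg.1 hθ)
          (fun F θ hP hRg hθ => hdu F θ hP hRg.1 hθ) (fun F θ hP hRg hθ => hdC F θ hP hRg.1 hθ) (fun F θ hP hRg hθ => hdv F θ hP hRg.1 hθ)
          (fun F θ hP hRg hθ => hdom F θ hP hRg.1 hθ) hζm h20 h21 h19)
        ((spine_rec13CCoPHOn_iff_forall_guarded (fun F (θ : Stage13HParams F 2) => ((θ.ZhUnity F 2 ∧ θ.SlotsNondegenerate₁₃ F 2) ∧ ¬ θ.ppSel = ppSelLiveOfRecord F 2 θ.ν θ.τ9 (EOfRecord₁₃ F 2 θ.toStage13Params) (wOfRecord₉ F 2 θ.toStage9Params)))).mpr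
          (hybridNE7Under_of_kernels_pin_fsc cr' 𝔯 ksel (fun {F} (θ : Stage13HParams F 2) => ((θ.ZhUnity F 2 ∧ θ.SlotsNondegenerate₁₃ F 2) ∧ ¬ θ.ppSel = ppSelLiveOfRecord F 2 θ.ν θ.τ9 (EOfRecord₁₃ F 2 θ.toStage13Params) (wOfRecord₉ F 2 θ.toStage9Params))) ℓ β hpin
            (fun F θ hP hRg hθ _ _ => ForSmallCouplings.of_forall fun g₀ os => by
              refine ⟨?_, ?_, ?_⟩
              · exact n14At_rateCarriersOfRecord₁₃CoPH_of_pinned 𝔯 hpin1 F θ hP g₀ os (ksel F θ hP g₀ os)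
              · obtain ⟨b, aS, ν, μ, α, β', c35, p, hb, haS, h⟩ := hpin2
                rw [h F θ hP g₀ os]
                exact n15At_fullGSizedObjects_family hb haS ν μ α β' c35 p F
              · show N16HolderAt (rateCarriersOfRecord₁₃CoPH 𝔯 F θ hP g₀ os (ksel F θ hP g₀ os)).ne3 β
                rw [rateCarriers_ne3_of_pinnedLoose hpinL F θ hP g₀ os (ksel F θ hP g₀ os)]
                exact h16 F ⟨θ, hP, hRg.1, hθ⟩)
            (fun F θ hP hRg hθ => hs F θ hP hRg.1 hθ) (fun F θ hP hRg hθ => hκ F θ hP hRg.1 hθ) (fun F θ hP hRg hθ => hcr F θ hP hRg.1 hθ)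
            (fun F θ hP hRg hθ => hρ F θ hP hRg.1 hθ) h20' h21' h19' hx'
            (fun F θ hP hRg hθ => hdec F θ hP hRg.1 hθ) (fun F θ hP hRg hθ => h18 F θ hP hRg.1 hθ)
            (fun F θ hP hRg hθ => h22 F θ hP hRg.1 hθ))))
      F θ hP.toCore hG hθ

/-! ## §2 … with the off-live part at dag-n20-w1's ONE-TERM READING `crOneTerm₁₃ K₀` (p598780): the off-live side = ONE Target row -/

/-- ★★★ **THE SAME WITH THE OFF-LIVE SPINE READING AT THE ONE-TERM READING** — APFL §2's split REPLAYED with the u3 inputs from APKZ §0 + dag-n18-w2: off the live line (Kꜰ) is taken at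
`cr' := crOneTerm₁₃ K₀` (N20 ∕ N21 ∕ N27x binders FREE by dag-n20-w1's `h20_shape_∕h21_shape_∕hx_shape_crOneTerm₁₃`; N19′ ⟸ ONE displayed row `htarget` through `ForSmallCouplings.mono` +
`core_crOneTerm₁₃_iff_target`).  So THE ITEM costs: the four pins · `h16` · the letter rows · `hr hinc h9` · the fourteen ℤ⁴ King rows · live `hζm h20 h21 h19` · off-live `htarget` ALONE.  NOT a
discharge; the Target, every rate and every King row are HYPOTHESES (0∕1 today). [bookkeeping] -/
theorem spineGivenEndpointR13SepCoPH_of_liveV5PinsAtCrOfRecord₁₃VAt_cut_offLiveOneTerm_v5pins_fsc_of_kingMechanismZ4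
    (hpin1 : Ne1PinnedOfRecord 𝔯)
    (hpin2 : ∃ (b aS : ℝ) (ν μ α β' : Fin 4) (c35 p : ℝ), 0 < b ∧ 0 < aS ∧
      ∀ (F : T4Family) (θ : Stage13HParams F 2) (hP : θ.Provisos₁₃CoPH F 2) (g₀ : ℕ → ℝ) (os : List (ULoop F)) (k : ℕ),
        (𝔯.lit F θ hP g₀ os).ne2 k = haveI := neZero_blockFactor F; fullGSizedObjects 3 F.hL b aS ν μ α β' c35 p)
    (hpinL : N16PinnedLoose 𝔯 ℓ₃ B)
    (hpin : ∀ (F : T4Family) (θ : Stage13HParams F 2) (hP : θ.Provisos₁₃CoPH F 2) (g₀ : ℕ → ℝ) (os : List (ULoop F)),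
      (𝔯.lit F θ hP g₀ os).u3 = objectsOfRecord₁₃ F 2 θ.toStage13Params (ℓ F θ))
    (h16 : ∀ (F : T4Family), (∃ θ : Stage13HParams F 2, θ.Provisos₁₃CoPH F 2 ∧ (θ.ZhUnity F 2 ∧ θ.SlotsNondegenerate₁₃ F 2) ∧ θ.Admissible F 2) →
      N16HolderAt (ne3OfRecord₁₁ F { ne3ConstLayerOfRecord₁₁ F 2 (ℓ₃ F) with
        dom := {V | V ∈ ne3DomOfRecord₁₁ F 2 0 0 ∧ V ∈ sfClass 4 F.L (ne3NperOfRecord₁₁ F 0 0) ((ℓ₃ F).ε / B F) 0} }) β)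
    (hs : ∀ (F : T4Family) (θ : Stage13HParams F 2), θ.Provisos₁₃CoPH F 2 → (θ.ZhUnity F 2 ∧ θ.SlotsNondegenerate₁₃ F 2) → θ.Admissible F 2 → (ℓ F θ).Signs)
    (hκ : ∀ (F : T4Family) (θ : Stage13HParams F 2), θ.Provisos₁₃CoPH F 2 → (θ.ZhUnity F 2 ∧ θ.SlotsNondegenerate₁₃ F 2) → θ.Admissible F 2 → 0 < (ℓ F θ).κ)
    (hcr : ∀ (F : T4Family) (θ : Stage13HParams F 2), θ.Provisos₁₃CoPH F 2 → (θ.ZhUnity F 2 ∧ θ.SlotsNondegenerate₁₃ F 2) → θ.Admissible F 2 →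
      betaPrime510 4 1 (ℓ F θ).κ ≤ (ℓ F θ).cr)
    (hρ : ∀ (F : T4Family) (θ : Stage13HParams F 2), θ.Provisos₁₃CoPH F 2 → (θ.ZhUnity F 2 ∧ θ.SlotsNondegenerate₁₃ F 2) → θ.Admissible F 2 →
      0 ≤ (ℓ F θ).ρ ∧ (ℓ F θ).ρ < 1)
    (hr : ∀ (F : T4Family) (θ : Stage13HParams F 2), θ.Provisos₁₃CoPH F 2 → (θ.ZhUnity F 2 ∧ θ.SlotsNondegenerate₁₃ F 2) → θ.Admissible F 2 → r F θ < 1)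
    (hinc : ∀ (F : T4Family) (θ : Stage13HParams F 2), θ.Provisos₁₃CoPH F 2 → (θ.ZhUnity F 2 ∧ θ.SlotsNondegenerate₁₃ F 2) → θ.Admissible F 2 →
      GeometricIncrementsOfRecord₁₃ F 2 θ.toStage13Params (r F θ))
    (h9 : ∀ (F : T4Family) (θ : Stage13HParams F 2), θ.Provisos₁₃CoPH F 2 → (θ.ZhUnity F 2 ∧ θ.SlotsNondegenerate₁₃ F 2) → θ.Admissible F 2 →
      WindowedNE9OfRecord₁₃ F 2 θ.toStage13Params (ℓ F θ).κ (ℓ F θ).moduli)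
    (hks : ∀ (F : T4Family) (θ : Stage13HParams F 2), θ.Provisos₁₃CoPH F 2 → (θ.ZhUnity F 2 ∧ θ.SlotsNondegenerate₁₃ F 2) → θ.Admissible F 2 →
      0 < κK F θ ∧ 0 ≤ θK F θ ∧ 0 ≤ sA F θ ∧ 0 ≤ sC F θ ∧ 0 ≤ sB F θ ∧ 0 ≤ cA F θ ∧ 0 ≤ cC F θ ∧ 0 ≤ cB F θ)
    (hq : ∀ (F : T4Family) (θ : Stage13HParams F 2) (k : ℕ), Function.Injective (q F θ k))
    (hd : ∀ (F : T4Family) (θ : Stage13HParams F 2) (k : ℕ) (μ ν : Fin 4) (z : Fin 4 → ℤ), l1 z ≤ l1 (p₁ F θ k μ ν z - p₂ F θ k μ ν z))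
    (hEA : ∀ (F : T4Family) (θ : Stage13HParams F 2), θ.Provisos₁₃CoPH F 2 → (θ.ZhUnity F 2 ∧ θ.SlotsNondegenerate₁₃ F 2) → θ.Admissible F 2 →
      ∀ g ∈ Window θ.γ, ∀ (k : ℕ) (μ ν : Fin 4) (z : Fin 4 → ℤ),
        (objectsOfRecord₁₃ F 2 θ.toStage13Params (ℓ F θ)).EA k g PUnit.unit (pt k μ ν z) = uA F θ g k μ ν z ⬝ᵥ (CA F θ g k μ ν z *ᵥ vA F θ g k μ ν z))
    (hEB : ∀ (F : T4Family) (θ : Stage13HParams F 2), θ.Provisos₁₃CoPH F 2 → (θ.ZhUnity F 2 ∧ θ.SlotsNondegenerate₁₃ F 2) → θ.Admissible F 2 →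
      ∀ b : ℝ, 0 < b → b ≤ θ.γ → ∀ g ∈ Window θ.γ, ∀ (k : ℕ) (μ ν : Fin 4) (z : Fin 4 → ℤ),
        (objectsOfRecord₁₃ F 2 θ.toStage13Params (ℓ F θ)).EB k b g (bg k μ ν z) (pt k μ ν z) = uB F θ b g k μ ν z ⬝ᵥ (CB F θ b g k μ ν z *ᵥ vB F θ b g k μ ν z))
    (hu : ∀ (F : T4Family) (θ : Stage13HParams F 2), θ.Provisos₁₃CoPH F 2 → (θ.ZhUnity F 2 ∧ θ.SlotsNondegenerate₁₃ F 2) → θ.Admissible F 2 →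
      ∀ g ∈ Window θ.γ, ∀ (k : ℕ) (μ ν : Fin 4) (z : Fin 4 → ℤ) (i : βK F θ k),
        |uA F θ g k μ ν z i| ≤ sA F θ * Real.exp (-(κK F θ * l1 (p₁ F θ k μ ν z - q F θ k i))))
    (hCA : ∀ (F : T4Family) (θ : Stage13HParams F 2), θ.Provisos₁₃CoPH F 2 → (θ.ZhUnity F 2 ∧ θ.SlotsNondegenerate₁₃ F 2) → θ.Admissible F 2 →
      ∀ g ∈ Window θ.γ, ∀ (k : ℕ) (μ ν : Fin 4) (z : Fin 4 → ℤ) (i i' : βK F θ k),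
        |CA F θ g k μ ν z i i'| ≤ sC F θ * Real.exp (-(κK F θ * l1 (q F θ k i - q F θ k i'))))
    (hvA : ∀ (F : T4Family) (θ : Stage13HParams F 2), θ.Provisos₁₃CoPH F 2 → (θ.ZhUnity F 2 ∧ θ.SlotsNondegenerate₁₃ F 2) → θ.Admissible F 2 →
      ∀ g ∈ Window θ.γ, ∀ (k : ℕ) (μ ν : Fin 4) (z : Fin 4 → ℤ) (i' : βK F θ k),
        |vA F θ g k μ ν z i'| ≤ sB F θ * Real.exp (-(κK F θ * l1 (q F θ k i' - p₂ F θ k μ ν z))))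
    (hCB : ∀ (F : T4Family) (θ : Stage13HParams F 2), θ.Provisos₁₃CoPH F 2 → (θ.ZhUnity F 2 ∧ θ.SlotsNondegenerate₁₃ F 2) → θ.Admissible F 2 →
      ∀ b : ℝ, 0 < b → b ≤ θ.γ → ∀ g ∈ Window θ.γ, ∀ (k : ℕ) (μ ν : Fin 4) (z : Fin 4 → ℤ) (i i' : βK F θ k),
        |CB F θ b g k μ ν z i i'| ≤ sC F θ * Real.exp (-(κK F θ * l1 (q F θ k i - q F θ k i'))))
    (hvB : ∀ (F : T4Family) (θ : Stage13HParams F 2), θ.Provisos₁₃CoPH F 2 → (θ.ZhUnity F 2 ∧ θ.SlotsNondegenerate₁₃ F 2) → θ.Admissible F 2 →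
      ∀ b : ℝ, 0 < b → b ≤ θ.γ → ∀ g ∈ Window θ.γ, ∀ (k : ℕ) (μ ν : Fin 4) (z : Fin 4 → ℤ) (i' : βK F θ k),
        |vB F θ b g k μ ν z i'| ≤ sB F θ * Real.exp (-(κK F θ * l1 (q F θ k i' - p₂ F θ k μ ν z))))
    (hdu : ∀ (F : T4Family) (θ : Stage13HParams F 2), θ.Provisos₁₃CoPH F 2 → (θ.ZhUnity F 2 ∧ θ.SlotsNondegenerate₁₃ F 2) → θ.Admissible F 2 →
      ∀ b : ℝ, 0 < b → b ≤ θ.γ → ∀ g ∈ Window θ.γ, ∀ (k : ℕ) (μ ν : Fin 4) (z : Fin 4 → ℤ) (i : βK F θ k),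
        |uB F θ b g k μ ν z i - uA F θ g k μ ν z i| ≤ cA F θ * θK F θ ^ (k + 1) * Real.exp (-(κK F θ * l1 (p₁ F θ k μ ν z - q F θ k i))))
    (hdC : ∀ (F : T4Family) (θ : Stage13HParams F 2), θ.Provisos₁₃CoPH F 2 → (θ.ZhUnity F 2 ∧ θ.SlotsNondegenerate₁₃ F 2) → θ.Admissible F 2 →
      ∀ b : ℝ, 0 < b → b ≤ θ.γ → ∀ g ∈ Window θ.γ, ∀ (k : ℕ) (μ ν : Fin 4) (z : Fin 4 → ℤ) (i i' : βK F θ k),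
        |CB F θ b g k μ ν z i i' - CA F θ g k μ ν z i i'| ≤ cC F θ * θK F θ ^ (k + 1) * Real.exp (-(κK F θ * l1 (q F θ k i - q F θ k i'))))
    (hdv : ∀ (F : T4Family) (θ : Stage13HParams F 2), θ.Provisos₁₃CoPH F 2 → (θ.ZhUnity F 2 ∧ θ.SlotsNondegenerate₁₃ F 2) → θ.Admissible F 2 →
      ∀ b : ℝ, 0 < b → b ≤ θ.γ → ∀ g ∈ Window θ.γ, ∀ (k : ℕ) (μ ν : Fin 4) (z : Fin 4 → ℤ) (i' : βK F θ k),
        |vB F θ b g k μ ν z i' - vA F θ g k μ ν z i'| ≤ cB F θ * θK F θ ^ (k + 1) * Real.exp (-(κK F θ * l1 (q F θ k i' - p₂ F θ k μ ν z))))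
    (hdom : ∀ (F : T4Family) (θ : Stage13HParams F 2), θ.Provisos₁₃CoPH F 2 → (θ.ZhUnity F 2 ∧ θ.SlotsNondegenerate₁₃ F 2) → θ.Admissible F 2 →
      (ℓ F θ).κ ≤ κK F θ / 2 ∧ θK F θ ≤ (ℓ F θ).θ₅ ∧
        (cA F θ * sC F θ * sB F θ + sA F θ * cC F θ * sB F θ + sA F θ * sC F θ * cB F θ) * K₁ 4 (κK F θ / 2) ^ 2 ≤ (ℓ F θ).C₅)
    (hζm : ∀ (F : T4Family) (θ : Stage13HParams F 2), θ.Provisos₁₃CoPH F 2 → ((θ.ZhUnity F 2 ∧ θ.SlotsNondegenerate₁₃ F 2) ∧ θ.ppSel = ppSelLiveOfRecord F 2 θ.ν θ.τ9 (EOfRecord₁₃ F 2 θ.toStage13Params) (wOfRecord₉ F 2 θ.toStage9Params)) → θ.Admissible F 2 →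
      ZetaMeasurable F 2 θ.ζ)
    (h20 : ∀ (F : T4Family) (θ : Stage13HParams F 2) (hP : θ.Provisos₁₃CoPH F 2), ((θ.ZhUnity F 2 ∧ θ.SlotsNondegenerate₁₃ F 2) ∧ θ.ppSel = ppSelLiveOfRecord F 2 θ.ν θ.τ9 (EOfRecord₁₃ F 2 θ.toStage13Params) (wOfRecord₉ F 2 θ.toStage9Params)) → θ.Admissible F 2 →
      ∀ (g₀ : ℕ → ℝ) (os : List (ULoop F)),
        ∃ W : ℕ → ℝ, RelWeightBound 1 (classSet₁₃ θ K₀ g₀) (weightA₁₃ θ hP K₀ g₀ os) (weightB₁₃ θ hP K₀ g₀ os) (badClass₁₃ θ K₀ g₀ (jc F θ hP g₀ os)) W)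
    (h21 : ∀ (F : T4Family) (θ : Stage13HParams F 2) (hP : θ.Provisos₁₃CoPH F 2), ((θ.ZhUnity F 2 ∧ θ.SlotsNondegenerate₁₃ F 2) ∧ θ.ppSel = ppSelLiveOfRecord F 2 θ.ν θ.τ9 (EOfRecord₁₃ F 2 θ.toStage13Params) (wOfRecord₉ F 2 θ.toStage9Params)) → θ.Admissible F 2 →
      ∀ (g₀ : ℕ → ℝ) (os : List (ULoop F)),
        ∃ Wsh : ℕ → ℝ, ShellWeightBound 1 (classSet₁₃ θ K₀ g₀) (weightA₁₃ θ hP K₀ g₀ os) (weightB₁₃ θ hP K₀ g₀ os) (sh F θ hP g₀ os).1 (sh F θ hP g₀ os).2 Wsh)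
    (h19 : ∀ (F : T4Family) (θ : Stage13HParams F 2) (hP : θ.Provisos₁₃CoPH F 2), ((θ.ZhUnity F 2 ∧ θ.SlotsNondegenerate₁₃ F 2) ∧ θ.ppSel = ppSelLiveOfRecord F 2 θ.ν θ.τ9 (EOfRecord₁₃ F 2 θ.toStage13Params) (wOfRecord₉ F 2 θ.toStage9Params)) → θ.Admissible F 2 →
      B16.EndStatementBPrinted (datumOfRecord₁₃CoPH F 2 θ hP).C → DagBinding.EndpointExistence (datumOfRecord₁₃CoPH F 2 θ hP).C.toB12 →
        ForSmallCouplings (datumOfRecord₁₃CoPH F 2 θ hP) fun g₀ => ∀ os : List (ULoop F),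
          (RatesHolderAt (datumOfRecord₁₃CoPH F 2 θ hP) (rateCarriersOfRecord₁₃CoPH 𝔯 F θ hP g₀ os (ksel F θ hP g₀ os)) β ∧
              ReadOutAt (datumOfRecord₁₃CoPH F 2 θ hP) (rateCarriersOfRecord₁₃CoPH 𝔯 F θ hP g₀ os (ksel F θ hP g₀ os)).u3 ∧
              (0 ≤ (rateCarriersOfRecord₁₃CoPH 𝔯 F θ hP g₀ os (ksel F θ hP g₀ os)).u3.ρ ∧
                (rateCarriersOfRecord₁₃CoPH 𝔯 F θ hP g₀ os (ksel F θ hP g₀ os)).u3.ρ < 1)) →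
            letI : DecidableEq (Σ K, SiteSeqKey F (K₀ + K)) := Classical.decEq _
            ∃ δ : ℕ → ℝ, NE7.Core 1 (F.side ^ 4) (classSet₁₃ θ K₀ g₀) (badClass₁₃ θ K₀ g₀ (jc F θ hP g₀ os))
              (fun K t x => weightA₁₃ θ hP K₀ g₀ os K t x - (sh F θ hP g₀ os).1 K t x)
              (fun K t x => weightB₁₃ θ hP K₀ g₀ os K t x - (sh F θ hP g₀ os).2 K t x) δ ∧ Summable δ)
    (htarget : ∀ (F : T4Family) (θ : Stage13HParams F 2) (hP : θ.Provisos₁₃CoPH F 2), ((θ.ZhUnity F 2 ∧ θ.SlotsNondegenerate₁₃ F 2) ∧ ¬ θ.ppSel = ppSelLiveOfRecord F 2 θ.ν θ.τ9 (EOfRecord₁₃ F 2 θ.toStage13Params) (wOfRecord₉ F 2 θ.toStage9Params)) → θ.Admissible F 2 →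
      B16.EndStatementBPrinted (datumOfRecord₁₃CoPH F 2 θ hP).C → DagBinding.EndpointExistence (datumOfRecord₁₃CoPH F 2 θ hP).C.toB12 →
        ForSmallCouplings (datumOfRecord₁₃CoPH F 2 θ hP) fun g₀ => ∀ os : List (ULoop F),
          (RatesHolderAt (datumOfRecord₁₃CoPH F 2 θ hP) (rateCarriersOfRecord₁₃CoPH 𝔯 F θ hP g₀ os (ksel F θ hP g₀ os)) β ∧
              ReadOutAt (datumOfRecord₁₃CoPH F 2 θ hP) (rateCarriersOfRecord₁₃CoPH 𝔯 F θ hP g₀ os (ksel F θ hP g₀ os)).u3 ∧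
              (0 ≤ (rateCarriersOfRecord₁₃CoPH 𝔯 F θ hP g₀ os (ksel F θ hP g₀ os)).u3.ρ ∧
                (rateCarriersOfRecord₁₃CoPH 𝔯 F θ hP g₀ os (ksel F θ hP g₀ os)).u3.ρ < 1)) →
            ∃ δ : ℕ → ℝ, Target ((F.side : ℝ) ^ 4) 1 δ (fun K => T4GenFunBounds.schemeZ ((datumOfRecord₁₃CoPH F 2 θ hP).scheme g₀) os (K₀ + K))) :
    SpineGivenEndpointR13SepCoPH := by
  obtain ⟨hdec, h18⟩ := kernelRowsOfRecord₁₃_guarded_of_kingMechanismZ4 ℓ q p₁ p₂ uA vA CA uB vB CB κK θK sA sC sB cA cC cB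
    (fun F (θ : Stage13HParams F 2) => (θ.ZhUnity F 2 ∧ θ.SlotsNondegenerate₁₃ F 2)) hs hks hq hd hEA hEB hu hCA hvA hCB hvB hdu hdC hdv hdom
  have h22 := fun (F : T4Family) (θ : Stage13HParams F 2) (hP : θ.Provisos₁₃CoPH F 2) (hG : (θ.ZhUnity F 2 ∧ θ.SlotsNondegenerate₁₃ F 2)) (hθ : θ.Admissible F 2) (k : ℕ) =>
    n22At_u3OfRecord₁₃_objectsOfRecord₁₃_of_geometricIncrements_of_windowedNE9 F 2 θ.toStage13Params (ℓ F θ) (hs F θ hP hG hθ) k (hr F θ hP hG hθ) (hinc F θ hP hG hθ) (h9 F θ hP hG hθ)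
  exact fun F θ hP hG hθ _ _ =>
    (spine_rec13CCoPHOn_iff_forall_guarded (fun F (θ : Stage13HParams F 2) => (θ.ZhUnity F 2 ∧ θ.SlotsNondegenerate₁₃ F 2))).mp
      (spine_rec13CCoPHOn_of_split (fun F (θ : Stage13HParams F 2) => (θ.ZhUnity F 2 ∧ θ.SlotsNondegenerate₁₃ F 2)) (fun F (θ : Stage13HParams F 2) => θ.ppSel = ppSelLiveOfRecord F 2 θ.ν θ.τ9 (EOfRecord₁₃ F 2 θ.toStage13Params) (wOfRecord₉ F 2 θ.toStage9Params))
        (spine_rec13CCoPHOn_live_of_v5pins_fsc_at_crOfRecord₁₃VAt_cut_of_kingMechanismZ4 K₀ jc sh β 𝔯 ksel ℓ r ℓ₃ B q p₁ p₂ uA vA CA uB vB CB κK θK sA sC sB cA cC cB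
          (fun F (θ : Stage13HParams F 2) => (θ.ZhUnity F 2 ∧ θ.SlotsNondegenerate₁₃ F 2)) hpin1 hpin2 hpinL hpin
          (fun F hF => h16 F (hF.elim fun θ h => ⟨θ, h.1, h.2.1.1, h.2.2⟩))
          (fun F θ hP hRg hθ => hs F θ hP hRg.1 hθ) (fun F θ hP hRg hθ => hκ F θ hP hRg.1 hθ) (fun F θ hP hRg hθ => hcr F θ hP hRg.1 hθ)
          (fun F θ hP hRg hθ => hρ F θ hP hRg.1 hθ) (fun F θ hP hRg hθ => hr F θ hP hRg.1 hθ) (fun F θ hP hRg hθ => hinc F θ hP hRg.1 hθ)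
          (fun F θ hP hRg hθ => h9 F θ hP hRg.1 hθ) (fun F θ hP hRg hθ => hks F θ hP hRg.1 hθ) hq hd (fun F θ hP hRg hθ => hEA F θ hP hRg.1 hθ)
          (fun F θ hP hRg hθ => hEB F θ hP hRg.1 hθ) (fun F θ hP hRg hθ => hu F θ hP hRg.1 hθ) (fun F θ hP hRg hθ => hCA F θ hP hRg.1 hθ)
          (fun F θ hP hRg hθ => hvA F θ hP hRg.1 hθ) (fun F θ hP hRg hθ => hCB F θ hP hRg.1 hθ) (fun F θ hP hRg hθ => hvB F θ hP hRg.1 hθ)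
          (fun F θ hP hRg hθ => hdu F θ hP hRg.1 hθ) (fun F θ hP hRg hθ => hdC F θ hP hRg.1 hθ) (fun F θ hP hRg hθ => hdv F θ hP hRg.1 hθ)
          (fun F θ hP hRg hθ => hdom F θ hP hRg.1 hθ) hζm h20 h21 h19)
        ((spine_rec13CCoPHOn_iff_forall_guarded (fun F (θ : Stage13HParams F 2) => ((θ.ZhUnity F 2 ∧ θ.SlotsNondegenerate₁₃ F 2) ∧ ¬ θ.ppSel = ppSelLiveOfRecord F 2 θ.ν θ.τ9 (EOfRecord₁₃ F 2 θ.toStage13Params) (wOfRecord₉ F 2 θ.toStage9Params)))).mpr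
          (hybridNE7Under_of_kernels_pin_fsc (crOneTerm₁₃ K₀) 𝔯 ksel (fun {F} (θ : Stage13HParams F 2) => ((θ.ZhUnity F 2 ∧ θ.SlotsNondegenerate₁₃ F 2) ∧ ¬ θ.ppSel = ppSelLiveOfRecord F 2 θ.ν θ.τ9 (EOfRecord₁₃ F 2 θ.toStage13Params) (wOfRecord₉ F 2 θ.toStage9Params))) ℓ β hpin
            (fun F θ hP hRg hθ _ _ => ForSmallCouplings.of_forall fun g₀ os => by
              refine ⟨?_, ?_, ?_⟩
              · exact n14At_rateCarriersOfRecord₁₃CoPH_of_pinned 𝔯 hpin1 F θ hP g₀ os (ksel F θ hP g₀ os)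
              · obtain ⟨b, aS, ν, μ, α, β', c35, p, hb, haS, h⟩ := hpin2
                rw [h F θ hP g₀ os]
                exact n15At_fullGSizedObjects_family hb haS ν μ α β' c35 p F
              · show N16HolderAt (rateCarriersOfRecord₁₃CoPH 𝔯 F θ hP g₀ os (ksel F θ hP g₀ os)).ne3 β
                rw [rateCarriers_ne3_of_pinnedLoose hpinL F θ hP g₀ os (ksel F θ hP g₀ os)]
                exact h16 F ⟨θ, hP, hRg.1, hθ⟩)
            (fun F θ hP hRg hθ => hs F θ hP hRg.1 hθ) (fun F θ hP hRg hθ => hκ F θ hP hRg.1 hθ) (fun F θ hP hRg hθ => hcr F θ hP hRg.1 hθ)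
            (fun F θ hP hRg hθ => hρ F θ hP hRg.1 hθ) (h20_shape_crOneTerm₁₃ K₀) (h21_shape_crOneTerm₁₃ K₀)
            (fun F θ hP hRg hθ hB hE => (htarget F θ hP hRg hθ hB hE).mono fun g₀ hg os hPr =>
              (core_crOneTerm₁₃_iff_target K₀ θ hP g₀ os).2 (hg os hPr))
            (hx_shape_crOneTerm₁₃ K₀)
            (fun F θ hP hRg hθ => hdec F θ hP hRg.1 hθ) (fun F θ hP hRg hθ => h18 F θ hP hRg.1 hθ)
            (fun F θ hP hRg hθ => h22 F θ hP hRg.1 hθ))))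
      F θ hP.toCore hG hθ

end Summit.QuantumFields.YangMills.Theorems.BalabanUVNodesN27SpineRecord
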